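import Summits.BirchSwinnertonDyer.BirchSwinnertonDyer.Theorems.KolyvaginDepthDoorMSymbolCertRelationsC
import Summits.BirchSwinnertonDyer.BirchSwinnertonDyer.Theorems.KolyvaginDepthDoorMSymbolCertOdd
import HarnessLib

/-!
# Route `KolyvaginDepthDoor`, crux `KolyvaginDepthSupplyKN` (stmt-BirchSwinnertonDyer-22820) —
# DEPTH TABLE v28, KIT 3′/5′ (composite level `N = q₁ q₂`): Manin-trick chains, period normalisation and the values
# `[a/n]^±_f` on a certified line — pair-index twins of kits 3 and 5

Helper file of the lead prover of line `levelone` (kdd-p1 g33; `--supports stmt-BirchSwinnertonDyer-22820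
--as helper`); it closes nothing and BSD is NOT proved by it. Sequel of `…MSymbolCertCosetsC` / `…RelationsC`; the
proofs are those of `…MSymbolCertPeriods` (g31), `…MSymbolCertOdd`, `…MSymbolCertKuriharaW` with the prime-level index
`e N i` replaced by the pair index `eC q₁ q₂ i` (the period-lattice normalisations are re-proved at an arbitrary level).
* `inftySymbol_eq_chain_sumC`, `modularSymbol_eq_chain_sumC` (`{∞, a/n}_f` as an explicit chain of `[eC i]_f`),
  `mem_chainIdxC_lt`, `re/im_chain_sum_eqC`;
* `exists_plusPeriod_divC`, `exists_minusPeriod_divC` (`t = ± Ω^±_f/(2g)` on an integral line), `cosetIdxC`, `eC_cosetIdxC`;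
* `exists_ratPlusSymbol_eqC`, `exists_ratMinusSymbol_eqC`: `[a/n]^±_f = ε · chainSumC φ /(2g)` with ONE `(g, ε)`;
(The Kurihara-number assembly `exists_kuriharaNumber_ne_zero_wC` is in the sibling `…MSymbolCertKuriharaC`.)

References: [CremonaAlgorithms1997] §2.3, §2.8; [MazurTateTeitelbaum1986Invent] §I.8; [Kim2022StructureSelmer] §1.4.3.
-/

set_option linter.dupNamespace false

noncomputable section

open scoped MatrixGroups ModularForm
open CongruenceSubgroup Matrix.SpecialLinearGroup ModularGroup Matrix
open Literature.NumberTheory.EllipticCurves Literature.NumberTheory.EllipticCurves.ModularForms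

namespace Summit.BirchSwinnertonDyer.BirchSwinnertonDyer.Theorems.KolyvaginDepthDoor.MSymbolCert

section CPrime

variable {q₁ q₂ : ℕ} [h₁ : Fact q₁.Prime] [h₂ : Fact q₂.Prime] [hne : Fact (q₁ ≠ q₂)]
variable (f : CuspForm (Gamma0 (q₁ * q₂)) 2)

/-! ## §1 Manin-trick chains -/

/-- **Manin's trick, explicit, composite level**: `{∞, k∞}_f = ∑_{i ∈ chainIdxC (z, w)} [eC i]_f` for `k = (x y; z w)`,
`|z| < fuel`. [cite: CremonaAlgorithms1997, §2.3] -/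
theorem inftySymbol_eq_chain_sumC : ∀ (fuel : ℕ) (k : SL(2, ℤ)), (k 1 0).natAbs < fuel →
    inftySymbol f k =
      ((chainIdxC q₁ q₂ fuel (k 1 0) (k 1 1)).map fun i => (msymbol (q₁ * q₂) (eC q₁ q₂ i)) f).sum := by
  intro fuel
  induction fuel with
  | zero => intro k hk; exact absurd hk (Nat.not_lt_zero _)
  | succ fuel ih =>
    intro k hk
    by_cases hz : k 1 0 = 0
    · simp [chainIdxC, hz, inftySymbol]
    · set m : ℤ := -(k 1 1 / k 1 0) with hm
      set k' : SL(2, ℤ) := k * T ^ m * S with hk'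
      have hk'10 : k' 1 0 = k 1 1 % k 1 0 := by
        simp only [hk', coe_mul, coe_S, coe_T_zpow, Matrix.mul_apply, Fin.sum_univ_two]
        simp [hm, Int.emod_def]
        ring
      have hk'11 : k' 1 1 = -(k 1 0) := by
        simp [hk', coe_mul, coe_S, coe_T_zpow, Matrix.mul_apply, Fin.sum_univ_two]
      have hlt : (k' 1 0).natAbs < fuel := by
        rw [hk'10]
        have h0 := Int.emod_nonneg (k 1 1) hz
        have h1 := Int.emod_lt_abs (k 1 1) hz
        zify at hk ⊢
        rw [abs_of_nonneg h0]
        omega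
      have hrec := ih k' hlt
      have hsplit : inftySymbol f k = msymbolSL f (k * T ^ m) + inftySymbol f k' := by
        simp only [msymbolSL, hk', inftySymbol_mul_T_zpow]
        ring
      have hms : msymbolSL f (k * T ^ m) =
          (msymbol (q₁ * q₂) (eC q₁ q₂ (idxCN q₁ q₂ (k 1 1 % k 1 0) (-(k 1 0))))) f := by
        have h00 : (((k * T ^ m)⁻¹ : SL(2, ℤ)) 0 0 : ℤ) = k 1 1 % k 1 0 := by
          rw [Int.emod_def]
          simp [Matrix.SpecialLinearGroup.coe_inv, Matrix.adjugate_fin_two, coe_T_zpow, Matrix.mul_apply,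
            Fin.sum_univ_two, hm]
          ring
        have h10 : (((k * T ^ m)⁻¹ : SL(2, ℤ)) 1 0 : ℤ) = -(k 1 0) := by
          simp [Matrix.SpecialLinearGroup.coe_inv, Matrix.adjugate_fin_two, coe_T_zpow, Matrix.mul_apply,
            Fin.sum_univ_two]
        rw [idxCN_eq_idxC, ← msymbolFunctional_apply,
          show msymbolFunctional (k * T ^ m) = msymbol (q₁ * q₂) (((k * T ^ m)⁻¹ : SL(2, ℤ)) : Gamma0Coset (q₁ * q₂)) by
            rw [msymbol_mk, inv_inv], mk_eq_eC, h00, h10]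
      rw [hsplit, hrec, hk'10, hk'11, chainIdxC, if_neg hz, List.map_cons, List.sum_cons, hms]

/-- **`{∞, a/n}_f` as an explicit chain of `[eC i]_f`** (`a w ≡ 1 (mod n)`, `0 < n < fuel`). [cite: CremonaAlgorithms1997, §2.3] -/
theorem modularSymbol_eq_chain_sumC (a w : ℤ) (n : ℕ) (hn : 0 < n) (hw : a * w % n = 1) (fuel : ℕ)
    (hfuel : n < fuel) :
    modularSymbol f ((a : ℚ) / n) =
      ((chainIdxC q₁ q₂ fuel n w).map fun i => (msymbol (q₁ * q₂) (eC q₁ q₂ i)) f).sum := by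
  have hsplit := Int.emod_def (a * w) n
  rw [hw] at hsplit
  have hdet : a * w - (a * w / n) * n = 1 := by linarith
  set y : ℤ := a * w / n with hy
  have h := inftySymbol_eq_chain_sumC f fuel (bezoutSL a y n w hdet) (by simpa [bezoutSL] using hfuel)
  have hn0 : (n : ℤ) ≠ 0 := by exact_mod_cast hn.ne'
  simp only [bezoutSL, inftySymbol, Matrix.of_apply, Matrix.cons_val', Matrix.cons_val_zero,
    Matrix.cons_val_one, Matrix.cons_val_fin_one, hn0, ↓reduceIte] at h
  rw [← h]
  norm_cast

omit h₁ h₂ hne in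
/-- Every chain index is `< (q₁ + 1)(q₂ + 1)`. [folklore] -/
theorem mem_chainIdxC_lt [Fact q₁.Prime] [Fact q₂.Prime] [Fact (q₁ ≠ q₂)] :
    ∀ (fuel : ℕ) (z w : ℤ), ∀ j ∈ chainIdxC q₁ q₂ fuel z w, j < (q₁ + 1) * (q₂ + 1) := by
  intro fuel
  induction fuel with
  | zero => intro z w j hj; simp [chainIdxC] at hj
  | succ fuel ih =>
    intro z w j hj
    simp only [chainIdxC] at hj
    split_ifs at hj with hz0
    · simp at hj
    · rcases List.mem_cons.mp hj with rfl | hj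
      · rw [idxCN_eq_idxC]; exact idxC_lt q₁ q₂ _ _
      · exact ih _ _ j hj

/-- Real parts along a chain on a line: `re ∑ [eC i]_f = t · ∑ φ` (hypothesis on the chain members only). [folklore] -/
theorem re_chain_sum_eqC (φ : ℕ → ℤ) (t : ℝ) (L : List ℕ) (hΨ : ∀ i ∈ L, ΨC f i = t * φ i) :
    ((L.map fun i => (msymbol (q₁ * q₂) (eC q₁ q₂ i)) f).sum).re = t * ((L.map φ).sum : ℤ) := by
  induction L with
  | nil => simp
  | cons i L ih =>
    have hi := hΨ i (by simp)
    have hL : ∀ j ∈ L, ΨC f j = t * φ j := fun j hj => hΨ j (by simp [hj])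
    simp only [List.map_cons, List.sum_cons, Complex.add_re, ih hL, Int.cast_add]
    rw [show ((msymbol (q₁ * q₂) (eC q₁ q₂ i)) f).re = ΨC f i from rfl, hi]
    ring

/-- Imaginary parts along a chain on a line. [folklore] -/
theorem im_chain_sum_eqC (φ : ℕ → ℤ) (t : ℝ) (L : List ℕ) (hΨ : ∀ i ∈ L, ΨmC f i = t * φ i) :
    ((L.map fun i => (msymbol (q₁ * q₂) (eC q₁ q₂ i)) f).sum).im = t * ((L.map φ).sum : ℤ) := by
  induction L with
  | nil => simp
  | cons i L ih =>
    have hi := hΨ i (by simp)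
    have hL : ∀ j ∈ L, ΨmC f j = t * φ j := fun j hj => hΨ j (by simp [hj])
    simp only [List.map_cons, List.sum_cons, Complex.add_im, ih hL, Int.cast_add]
    rw [show ((msymbol (q₁ * q₂) (eC q₁ q₂ i)) f).im = ΨmC f i from rfl, hi]
    ring

/-! ## §2 Period normalisation (any level) and the index of a coset -/

omit h₁ h₂ hne in
/-- **Normalisation (plus), any level**: if `re [q]_f = t · φ(q)` on all cosets, `φ` integral, `f` a normalised rational
newform, then `t = ± Ω⁺_f/(2g)`, `g ≥ 1` (kit 3's `exists_plusPeriod_div` VERBATIM, no primality). [cite: CremonaAlgorithms1997, §2.8] -/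
theorem exists_plusPeriod_divC [NeZero (q₁ * q₂)] (hf : IsNewform0 f) (hQ : coeffField f = ⊥) {t : ℝ}
    {φ : Gamma0Coset (q₁ * q₂) → ℤ} (hΨ : ∀ q, ((msymbol (q₁ * q₂) q) f).re = t * φ q) :
    ∃ g : ℕ, 0 < g ∧ (t = plusPeriod f / (2 * g) ∨ t = -(plusPeriod f / (2 * g))) := by
  have hΩ : 0 < plusPeriod f := IsNewform0.plusPeriod_pos_holds hf hQ
  have hre : realPeriods f = AddSubgroup.zmultiples (plusPeriod f / 2) :=
    realPeriods_eq_zmultiples_of_plusPeriod_pos f hΩ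
  have hlat : ∀ x ∈ periodLattice f, ∃ m : ℤ, x.re = t * m := by
    intro x hx
    induction hx using AddSubgroup.closure_induction with
    | mem x hx =>
      obtain ⟨γ, rfl⟩ := hx
      obtain ⟨c, hcint, hcm, -⟩ := exists_chain (N := q₁ * q₂) (γ : SL(2, ℤ))
      have hval : cuspSymbol f γ = (msymbolMap (q₁ * q₂) c) f := by
        rw [cuspSymbol_eq_inftySymbol, ← inftyFunctional_apply, ← hcm]
      rw [hval, msymbolMap, Fintype.linearCombination_apply, LinearMap.sum_apply, Complex.re_sum]
      choose mq hmq using hcint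
      refine ⟨∑ q, mq q * φ q, ?_⟩
      push_cast
      rw [Finset.mul_sum]
      refine Finset.sum_congr rfl fun q _ => ?_
      rw [LinearMap.smul_apply, Complex.smul_re, hΨ q, hmq q, Rat.smul_def]
      push_cast
      ring
    | zero => exact ⟨0, by simp⟩
    | add x y _ _ hx hy =>
      obtain ⟨a, ha⟩ := hx; obtain ⟨b, hb⟩ := hy
      exact ⟨a + b, by rw [Complex.add_re, ha, hb]; push_cast; ring⟩
    | neg x _ hx =>
      obtain ⟨a, ha⟩ := hx
      exact ⟨-a, by rw [Complex.neg_re, ha]; push_cast; ring⟩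
  have hmem : plusPeriod f / 2 ∈ realPeriods f := by rw [hre]; exact AddSubgroup.mem_zmultiples _
  rw [realPeriods, AddSubgroup.mem_map] at hmem
  obtain ⟨x, hx, hxre⟩ := hmem
  obtain ⟨m, hm⟩ := hlat x hx
  have hxre' : x.re = plusPeriod f / 2 := hxre
  rw [hxre'] at hm
  have hm0 : m ≠ 0 := by
    rintro rfl
    simp at hm
    linarith
  refine ⟨m.natAbs, Int.natAbs_pos.mpr hm0, ?_⟩
  rcases le_or_gt 0 m with hpos | hneg
  · left
    have : (m.natAbs : ℝ) = m := by rw [← Int.cast_natCast, Int.natAbs_of_nonneg hpos]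
    rw [this]
    have hmR : (m : ℝ) ≠ 0 := by exact_mod_cast hm0
    field_simp
    linarith
  · right
    have : (m.natAbs : ℝ) = -m := by
      rw [← Int.cast_natCast, Int.ofNat_natAbs_of_nonpos hneg.le, Int.cast_neg]
    rw [this]
    have hmR : (m : ℝ) ≠ 0 := by exact_mod_cast hm0
    field_simp
    linarith

omit h₁ h₂ hne in
/-- **Normalisation (minus), any level**: `im [q]_f = t · φ(q)` on all cosets ⟹ `t = ± Ω⁻_f/(2g)` (kit 5's
`exists_minusPeriod_div` VERBATIM, no primality). [cite: CremonaAlgorithms1997, §2.8] -/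
theorem exists_minusPeriod_divC [NeZero (q₁ * q₂)] (hf : IsNewform0 f) (hQ : coeffField f = ⊥) {t : ℝ}
    {φ : Gamma0Coset (q₁ * q₂) → ℤ} (hΨ : ∀ q, ((msymbol (q₁ * q₂) q) f).im = t * φ q) :
    ∃ g : ℕ, 0 < g ∧ (t = minusPeriod f / (2 * g) ∨ t = -(minusPeriod f / (2 * g))) := by
  have hΩ : 0 < minusPeriod f := IsNewform0.minusPeriod_pos_holds hf hQ
  have him : imagPeriods f = AddSubgroup.zmultiples (minusPeriod f / 2) :=
    imagPeriods_eq_zmultiples_of_minusPeriod_pos f hΩ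
  have hlat : ∀ x ∈ periodLattice f, ∃ m : ℤ, x.im = t * m := by
    intro x hx
    induction hx using AddSubgroup.closure_induction with
    | mem x hx =>
      obtain ⟨γ, rfl⟩ := hx
      obtain ⟨c, hcint, hcm, -⟩ := exists_chain (N := q₁ * q₂) (γ : SL(2, ℤ))
      have hval : cuspSymbol f γ = (msymbolMap (q₁ * q₂) c) f := by
        rw [cuspSymbol_eq_inftySymbol, ← inftyFunctional_apply, ← hcm]
      rw [hval, msymbolMap, Fintype.linearCombination_apply, LinearMap.sum_apply, Complex.im_sum]
      choose mq hmq using hcint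
      refine ⟨∑ q, mq q * φ q, ?_⟩
      push_cast
      rw [Finset.mul_sum]
      refine Finset.sum_congr rfl fun q _ => ?_
      rw [LinearMap.smul_apply, Complex.smul_im, hΨ q, hmq q, Rat.smul_def]
      push_cast
      ring
    | zero => exact ⟨0, by simp⟩
    | add x y _ _ hx hy =>
      obtain ⟨a, ha⟩ := hx; obtain ⟨b, hb⟩ := hy
      exact ⟨a + b, by rw [Complex.add_im, ha, hb]; push_cast; ring⟩
    | neg x _ hx =>
      obtain ⟨a, ha⟩ := hx
      exact ⟨-a, by rw [Complex.neg_im, ha]; push_cast; ring⟩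
  have hmem : minusPeriod f / 2 ∈ imagPeriods f := by rw [him]; exact AddSubgroup.mem_zmultiples _
  rw [imagPeriods, AddSubgroup.mem_map] at hmem
  obtain ⟨x, hx, hxim⟩ := hmem
  obtain ⟨m, hm⟩ := hlat x hx
  have hxim' : x.im = minusPeriod f / 2 := hxim
  rw [hxim'] at hm
  have hm0 : m ≠ 0 := by
    rintro rfl
    simp at hm
    linarith
  refine ⟨m.natAbs, Int.natAbs_pos.mpr hm0, ?_⟩
  rcases le_or_gt 0 m with hpos | hneg
  · left
    have : (m.natAbs : ℝ) = m := by rw [← Int.cast_natCast, Int.natAbs_of_nonneg hpos]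
    rw [this]
    have hmR : (m : ℝ) ≠ 0 := by exact_mod_cast hm0
    field_simp
    linarith
  · right
    have : (m.natAbs : ℝ) = -m := by
      rw [← Int.cast_natCast, Int.ofNat_natAbs_of_nonpos hneg.le, Int.cast_neg]
    rw [this]
    have hmR : (m : ℝ) ≠ 0 := by exact_mod_cast hm0
    field_simp
    linarith

variable (q₁ q₂) in
/-- The pair index of a coset (`eC (cosetIdxC q) = q`). [folklore] -/
def cosetIdxC (q : Gamma0Coset (q₁ * q₂)) : ℕ :=
  idxC q₁ q₂ ((Quotient.out q : SL(2, ℤ)) 0 0 : ℤ) ((Quotient.out q : SL(2, ℤ)) 1 0 : ℤ)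

/-- Every coset is `eC` of its index. [folklore] -/
theorem eC_cosetIdxC (q : Gamma0Coset (q₁ * q₂)) : eC q₁ q₂ (cosetIdxC q₁ q₂ q) = q := by
  rw [cosetIdxC, ← mk_eq_eC]
  exact QuotientGroup.out_eq' q

omit hne in
/-- `cosetIdxC q < (q₁ + 1)(q₂ + 1)`. [folklore] -/
theorem cosetIdxC_lt (q : Gamma0Coset (q₁ * q₂)) : cosetIdxC q₁ q₂ q < (q₁ + 1) * (q₂ + 1) := idxC_lt q₁ q₂ _ _

/-! ## §3 The values `[a/n]^±_f` on a certified line -/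

/-- **The value of `[a/n]⁺_f` on the line through `φ`** (composite level): if `re [eC i]_f = t φ(i)` for all pair
indices `i < (q₁+1)(q₂+1)` (`f` a normalised rational newform), there are `g ≥ 1` and `ε = ±1`, the same for all
`(a, n, w)`, with `[a/n]⁺_f = ε · chainSumC φ fuel n w / (2g)` (`a w ≡ 1 (mod n)`, `0 < n < fuel`).
[cite: MazurTateTeitelbaum1986Invent, §I.8] -/
theorem exists_ratPlusSymbol_eqC (hf : IsNewform0 f) (hQ : coeffField f = ⊥) {t : ℝ} {φ : ℕ → ℤ}
    (hΨ : ∀ i < (q₁ + 1) * (q₂ + 1), ΨC f i = t * φ i) :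
    ∃ (g : ℕ) (ε : ℤ), 0 < g ∧ (ε = 1 ∨ ε = -1) ∧
      ∀ (a w : ℤ) (n : ℕ), 0 < n → a * w % n = 1 → ∀ fuel : ℕ, n < fuel →
        ratPlusSymbol f ((a : ℚ) / n) = ε * chainSumC q₁ q₂ φ fuel n w / (2 * g) := by
  have hall : ∀ q : Gamma0Coset (q₁ * q₂), ((msymbol (q₁ * q₂) q) f).re = t * φ (cosetIdxC q₁ q₂ q) := by
    intro q
    rw [← hΨ (cosetIdxC q₁ q₂ q) (cosetIdxC_lt q), ΨC, eC_cosetIdxC]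
  obtain ⟨g, hg, ht⟩ := exists_plusPeriod_divC f hf hQ hall
  have hΩ : 0 < plusPeriod f := IsNewform0.plusPeriod_pos_holds hf hQ
  have hreal : ∀ m, (cuspCoeff f m).im = 0 := cuspCoeff_im_eq_zero_of_coeffField_eq_bot hQ
  set ε : ℤ := if t = plusPeriod f / (2 * g) then 1 else -1 with hε
  have hε1 : ε = 1 ∨ ε = -1 := by rw [hε]; split_ifs <;> simp
  have htε : t = (ε : ℝ) * (plusPeriod f / (2 * g)) := by
    rw [hε]; split_ifs with h
    · simp [h]
    · rcases ht with h' | h'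
      · exact absurd h' h
      · rw [h']; simp
  refine ⟨g, ε, hg, hε1, ?_⟩
  intro a w n hn hw fuel hfuel
  have hsym : (ratPlusSymbol f ((a : ℚ) / n) : ℝ) = (modularSymbol f ((a : ℚ) / n)).re / plusPeriod f := by
    rw [ratCast_ratPlusSymbol_holds hf hQ, normalizedPlusSymbol,
      plusSymbol_eq_re_of f (modularSymbol_neg_eq_conj_holds f) hreal]
    norm_cast
  have hchain := modularSymbol_eq_chain_sumC f a w n hn hw fuel hfuel
  have hre := re_chain_sum_eqC f φ t (chainIdxC q₁ q₂ fuel n w)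
    (fun i hi => hΨ i (mem_chainIdxC_lt fuel _ _ i hi))
  have hΩ0 : plusPeriod f ≠ 0 := hΩ.ne'
  have hg0 : (g : ℝ) ≠ 0 := by exact_mod_cast hg.ne'
  have key : (ratPlusSymbol f ((a : ℚ) / n) : ℝ) = (ε : ℝ) * (chainSumC q₁ q₂ φ fuel n w : ℝ) / (2 * g) := by
    rw [hsym, hchain, hre, htε, chainSumC]
    field_simp
  have : ((ratPlusSymbol f ((a : ℚ) / n) : ℚ) : ℝ) = ((ε * chainSumC q₁ q₂ φ fuel n w / (2 * g) : ℚ) : ℝ) := by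
    rw [key]; push_cast; ring
  exact_mod_cast this

/-- **The value of `[a/n]⁻_f` on the line through `φ⁻`** (composite level; as `exists_ratPlusSymbol_eqC` with
imaginary parts and `Ω⁻`). [cite: MazurTateTeitelbaum1986Invent, §I.8] -/
theorem exists_ratMinusSymbol_eqC (hf : IsNewform0 f) (hQ : coeffField f = ⊥) {t : ℝ} {φ : ℕ → ℤ}
    (hΨ : ∀ i < (q₁ + 1) * (q₂ + 1), ΨmC f i = t * φ i) :
    ∃ (g : ℕ) (ε : ℤ), 0 < g ∧ (ε = 1 ∨ ε = -1) ∧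
      ∀ (a w : ℤ) (n : ℕ), 0 < n → a * w % n = 1 → ∀ fuel : ℕ, n < fuel →
        ratMinusSymbol f ((a : ℚ) / n) = ε * chainSumC q₁ q₂ φ fuel n w / (2 * g) := by
  have hall : ∀ q : Gamma0Coset (q₁ * q₂), ((msymbol (q₁ * q₂) q) f).im = t * φ (cosetIdxC q₁ q₂ q) := by
    intro q
    rw [← hΨ (cosetIdxC q₁ q₂ q) (cosetIdxC_lt q), ΨmC, eC_cosetIdxC]
  obtain ⟨g, hg, ht⟩ := exists_minusPeriod_divC f hf hQ hall
  have hΩ : 0 < minusPeriod f := IsNewform0.minusPeriod_pos_holds hf hQ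
  have hreal : ∀ m, (cuspCoeff f m).im = 0 := cuspCoeff_im_eq_zero_of_coeffField_eq_bot hQ
  set ε : ℤ := if t = minusPeriod f / (2 * g) then 1 else -1 with hε
  have hε1 : ε = 1 ∨ ε = -1 := by rw [hε]; split_ifs <;> simp
  have htε : t = (ε : ℝ) * (minusPeriod f / (2 * g)) := by
    rw [hε]; split_ifs with h
    · simp [h]
    · rcases ht with h' | h'
      · exact absurd h' h
      · rw [h']; simp
  refine ⟨g, ε, hg, hε1, ?_⟩
  intro a w n hn hw fuel hfuel
  have hsym : (ratMinusSymbol f ((a : ℚ) / n) : ℝ) = (modularSymbol f ((a : ℚ) / n)).im / minusPeriod f := by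
    rw [ratCast_ratMinusSymbol f hf hQ, normalizedMinusSymbol, minusSymbol_eq_im_mul_I_holds f hreal]
    simp
  have hchain := modularSymbol_eq_chain_sumC f a w n hn hw fuel hfuel
  have hre := im_chain_sum_eqC f φ t (chainIdxC q₁ q₂ fuel n w)
    (fun i hi => hΨ i (mem_chainIdxC_lt fuel _ _ i hi))
  have hΩ0 : minusPeriod f ≠ 0 := hΩ.ne'
  have hg0 : (g : ℝ) ≠ 0 := by exact_mod_cast hg.ne'
  have key : (ratMinusSymbol f ((a : ℚ) / n) : ℝ) = (ε : ℝ) * (chainSumC q₁ q₂ φ fuel n w : ℝ) / (2 * g) := by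
    rw [hsym, hchain, hre, htε, chainSumC]
    field_simp
  have : ((ratMinusSymbol f ((a : ℚ) / n) : ℚ) : ℝ) = ((ε * chainSumC q₁ q₂ φ fuel n w / (2 * g) : ℚ) : ℝ) := by
    rw [key]; push_cast; ring
  exact_mod_cast this

end CPrime

end Summit.BirchSwinnertonDyer.BirchSwinnertonDyer.Theorems.KolyvaginDepthDoor.MSymbolCert

end
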